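import Summits.QuantumFields.YangMills.Theorems.LuscherReductionDressedRitzPolyakovLiftTransplantChart
import Summits.QuantumFields.YangMills.Theorems.LuscherReductionDressedRitzPolyakovLiftDressed
import Summits.QuantumFields.YangMills.Theorems.LuscherReductionDressedRitzPolyakovLiftStaticsPrep
import Summits.QuantumFields.YangMills.Theorems.LuscherReductionOneSiteLevelsL2Pos
import Literature.Analysis.OperatorTheory.YangMillsMatrixModelEigenfunctionSupport
import HarnessLib

/-!
# Line «polyakovlift» r6 on crux `DressedRitz` (stmt-QuantumFields-20205): clause (o0) of S-STAT″ for EVERY root-transplant basis —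
# the dressed lifted channel vectors of `TransplantBasisL` members have positive norm

Fleet-service module of seat ym-infvol-p1 g7 (route `LuscherReduction`, femto rung R2b1; holder of S-STAT `stub_liftStatics`, skeleton r6 `09c950a55cd7b1f3`:
`∀ k, StaticsForL (TransplantBasisL k)`).  The r5 (o0) (`dressedLiftFamily_o0`, via `l2_ins_flowLiftAt_self_pos`) used the exact one-site eigen-equation of
`g_iω` (continuity by `continuous_eigenRatio`, non-constancy by `eigenRatio_not_const`).  For the r6 observables `g_i = (χ_R f_{i+1}/f_0) ∘ rootCoord L (Λ/2)`
neither is available: the gnomonic chart is discontinuous on the equator, and `f_{i+1}` is only known not to vanish SOMEWHERE.  Replacement: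

* §1 `l2_self_pos_of_continuousAt` — a physical fine-lattice function with ONE continuity point where it is non-zero has positive norm (Haar charges opens);
* §2 `transplantObsL_two_values` — two REGULAR configurations (chart continuity and section: `…TransplantChart.lean`) where `g_i` takes the values `≠ 0`
  and `= 0`: the first from the Literature theorem `exists_ne_zero_in_ball_of_clauses` (an eigenfunction at level `E` cannot vanish on the ball of radius
  `> 3E/2` — valley confinement; UNIFORM in the family) and a null-set avoidance of the coordinate hyperplanes, the second far out on the cut-off;
* §3 ★ `liftVec_transplantObsL_pos` and ★★ `dressedLiftFamily_o0_transplantL` — **clause (o0) of `StaticClauses` for every `TransplantBasisL k L Λ g` basis, every raw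
  vacuum, every fine lattice `L ≥ 1` and `β ≥ 1`, as soon as `12·physLevel(k+1)·Λ < 1`** (the pinned radius `R ≥ 1/(8Λ)` then exceeds `3E/2` for every level
  of the family); ★★ `o0_level_transplantL` — the (o0) half of the registered level-`k` text with `lam0 = 1/(24·physLevel(k+1)+24)`, `L0 = 0`, ANY `C`.

HONEST FRAMING: fixed-lattice continuity/surjectivity bookkeeping + one spectral fact about the 9-dimensional matrix model; (o2) of S-STAT″ (RG above the first
repeated isotype; symmetry-protected below) is untouched; nothing here bears on infinite volume, the continuum limit or the Clay gap.
References: M. Lüscher, NPB 219 (1983) 233 [cite: Luscher1983, §2–§3]; M. Lüscher, U. Wolff, NPB 339 (1990) 222 [cite: LuscherWolff1990];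
B. Simon, Ann. Phys. 146 (1983) [cite: SimonB1983DiscreteSpectrum, §2 eq. (5)]; Reed–Simon IV [cite: ReedSimonIV1978, Thm XIII.43 and Thm XIII.44].
-/

set_option autoImplicit false

noncomputable section

open MeasureTheory Filter Topology Real
open Literature.MathematicalPhysics.QuantumFieldTheory (GaugeConfig Site gaugeTransform wilsonFlow continuous_wilsonFlow)
open Literature.Analysis.OperatorTheory.YMMatrixModel
open Literature.MathematicalPhysics.QuantumFieldTheory.Balaban1983to89.T4CubeChartGnomonic (gnoPoint)
open scoped BigOperators ENNReal

namespace Summit.QuantumFields.YangMills.Theorems.FemtoTransferGap.PolyakovLift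

open Summit.QuantumFields.YangMills.Theorems.FemtoTransferGap

/-! ## §1 Positivity of the norm from one continuity point -/

/-- **A physical fine-lattice function that is non-zero at a point of continuity has positive norm** (the product Haar measure charges open sets).
[cite: ReedSimonIV1978, Thm XIII.43 and Thm XIII.44] -/
theorem l2_self_pos_of_continuousAt {L : ℕ} [NeZero L] {ψ : GaugeConfig 3 L SU2 → ℝ} (hψ : IsPhys ψ) {U₀ : GaugeConfig 3 L SU2}
    (hc : ContinuousAt ψ U₀) (h0 : ψ U₀ ≠ 0) : 0 < l2 ψ ψ := by
  haveI := configMeasure_isOpenPosMeasure (G := SU2) L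
  unfold l2
  have hnn : 0 ≤ fun U => ψ U * ψ U := fun U => mul_self_nonneg _
  rw [integral_pos_iff_support_of_nonneg hnn (hψ.integrable_mul hψ)]
  have hmem : {U | ψ U ≠ 0} ∈ 𝓝 U₀ := hc.preimage_mem_nhds (isOpen_ne.mem_nhds h0)
  obtain ⟨O, hOsub, hOopen, hU₀O⟩ := mem_nhds_iff.1 hmem
  calc (0 : ℝ≥0∞) < configMeasure SU2 L O := hOopen.measure_pos _ ⟨U₀, hU₀O⟩
    _ ≤ configMeasure SU2 L (Function.support fun U => ψ U * ψ U) :=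
        measure_mono fun U hU => by
          simp only [Function.mem_support]
          exact mul_ne_zero (hOsub hU) (hOsub hU)

/-! ## §2 Two regular configurations where a transplanted observable takes different values -/

/-- ★ **Two values.**  For an AL1 eigenfamily with `f_0 > 0`, a radius `1 ≤ R ≤ 1/(4Λ)` with `3·physLevel(i+2)/2 < R`, `Λ > 0` and `L ≥ 1`, the observable
`g_i = transplantObsL L Λ R f i` has two continuity points where it takes a non-zero value and the value `0` respectively.
[cite: Luscher1983, §2–§3] [cite: SimonB1983DiscreteSpectrum, §2 eq. (5)] -/
theorem transplantObsL_two_values {k : ℕ} {f : Fin (k + 1) → ZM → ℝ} (hf : IsEigenFamily k f) (hpos : ∀ x, 0 < f 0 x) {R Λ : ℝ}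
    (hR : 1 ≤ R) (hΛ : 0 < Λ) (hRΛ : R * Λ ≤ 1 / 4) {L : ℕ} (hL : 1 ≤ L) (i : Fin k) (hRi : 3 / 2 * physLevel ((i : ℕ) + 2) < R) :
    ∃ W₁ W₂ : Cfg, ContinuousAt (transplantObsL L Λ R f i) W₁ ∧ ContinuousAt (transplantObsL L Λ R f i) W₂ ∧
      transplantObsL L Λ R f i W₁ ≠ 0 ∧ transplantObsL L Λ R f i W₂ = 0 := by
  have hR0 : 0 < R := lt_of_lt_of_le one_pos hR
  have hμ : 0 < Λ / 2 := half_pos hΛ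
  have hμR : Λ / 2 * R < π / 2 := by nlinarith [Real.pi_gt_three]
  -- NEAR: a regular point in the ball where `f_{i+1} ≠ 0`
  have hRi' : 3 / 2 * physLevel ((i.succ : ℕ) + 1) < R := by rw [Fin.val_succ]; exact hRi
  obtain ⟨y₀, hy₀R, hy₀⟩ := exists_ne_zero_in_ball_of_clauses hf.1 hf.2.2.1 hf.2.2.2.1 hf.2.2.2.2 i.succ hRi'
  have hO : IsOpen {y : ZM | ‖y‖ < R ∧ f i.succ y ≠ 0} :=
    (isOpen_lt continuous_norm continuous_const).inter (isOpen_ne_fun ((hf.1 _ 0).continuous) continuous_const)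
  obtain ⟨y, ⟨hyR, hyf⟩, hyreg⟩ := exists_regular_point hO ⟨y₀, hy₀R, hy₀⟩
  have hyμ : ∀ j, Λ / 2 * Real.sqrt (linkNormSq y j) < π / 2 := fun j =>
    lt_of_le_of_lt (mul_le_mul_of_nonneg_left ((sqrt_linkNormSq_le_norm y j).trans hyR.le) hμ.le) hμR
  obtain ⟨W₁, hW₁reg, hW₁y⟩ := exists_regular_preimage_rootCoord hL hμ hyreg hyμ
  -- FAR: a regular point outside the cut-off
  set yf : ZM := WithLp.toLp 2 fun p : Fin 3 × Fin 3 => if p.2 = 0 then R else 0 with hyf_def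
  have hyf_apply : ∀ p : Fin 3 × Fin 3, yf p = if p.2 = 0 then R else 0 := fun p => rfl
  have hns_f : ∀ j, linkNormSq yf j = R ^ 2 := fun j => by
    unfold linkNormSq
    simp only [hyf_apply]
    rw [show (∑ a : Fin 3, (if a = 0 then R else 0) ^ 2) = ∑ a : Fin 3, (if a = 0 then R ^ 2 else 0) from
      Finset.sum_congr rfl fun a _ => by split_ifs <;> simp, Finset.sum_ite_eq']
    simp
  have hyf_reg : ∀ j, 0 < linkNormSq yf j := fun j => by rw [hns_f]; positivity
  have hyf_μ : ∀ j, Λ / 2 * Real.sqrt (linkNormSq yf j) < π / 2 := fun j => by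
    rw [hns_f, Real.sqrt_sq hR0.le]; exact hμR
  obtain ⟨W₂, hW₂reg, hW₂y⟩ := exists_regular_preimage_rootCoord hL hμ hyf_reg hyf_μ
  have hnorm_f : 2 * R ^ 2 ≤ ‖yf‖ ^ 2 := by
    have h1 : ‖yf‖ ^ 2 = ∑ p : Fin 3 × Fin 3, yf p ^ 2 := by
      rw [EuclideanSpace.norm_eq, Real.sq_sqrt (Finset.sum_nonneg fun _ _ => sq_nonneg _)]
      exact Finset.sum_congr rfl fun p _ => by rw [Real.norm_eq_abs, sq_abs]
    have h2 : ∑ p : Fin 3 × Fin 3, yf p ^ 2 = 3 * R ^ 2 := by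
      rw [Fintype.sum_prod_type]
      have : ∀ j : Fin 3, ∑ a : Fin 3, yf (j, a) ^ 2 = R ^ 2 := fun j => hns_f j
      simp only [this, Finset.sum_const, Finset.card_univ, Fintype.card_fin, nsmul_eq_mul]
      norm_num
    rw [h1, h2]
    nlinarith [sq_nonneg R]
  refine ⟨W₁, W₂, continuousAt_transplantObsL hf hpos R hΛ L i hW₁reg, continuousAt_transplantObsL hf hpos R hΛ L i hW₂reg, ?_, ?_⟩
  · show transplantFn R f i (rootCoord L (Λ / 2) W₁) ≠ 0
    rw [hW₁y, transplantFn, radialCutoff_eq_one hR0 hyR.le, one_mul]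
    exact div_ne_zero hyf (hpos y).ne'
  · show transplantFn R f i (rootCoord L (Λ / 2) W₂) = 0
    rw [hW₂y, transplantFn, radialCutoff_eq_zero hR0 hnorm_f, zero_mul]

/-! ## §3 ★ Clause (o0) for every root-transplant basis -/

/-- ★ **The lifted channel vector of a transplanted observable has positive norm** — at every flow time and base point, for every raw vacuum on every fine
lattice `(ℤ/L)³`, as soon as the cut-off radius exceeds `3·physLevel(i+2)/2`: `g_i` is continuous at two regular configurations with different values
(§4), the flowed Polyakov holonomy map is onto and continuous, the raw vacuum is continuous and nowhere zero, so `u = (g_i∘Π_t − ⟨g_i∘Π_t⟩_φ)·φ` is non-zero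
at a continuity point (§1). [cite: Luscher2010, §2] [cite: ReedSimonIV1978, Thm XIII.43 and Thm XIII.44] -/
theorem liftVec_transplantObsL_pos {L : ℕ} [NeZero L] (β : ℝ) {φ : GaugeConfig 3 L SU2 → ℝ} (hvac : IsRawVacuum β φ)
    {k : ℕ} {f : Fin (k + 1) → ZM → ℝ} (hf : IsEigenFamily k f) (hpos : ∀ x, 0 < f 0 x) {R Λ : ℝ}
    (hR : 1 ≤ R) (hΛ : 0 < Λ) (hRΛ : R * Λ ≤ 1 / 4) (i : Fin k) (hRi : 3 / 2 * physLevel ((i : ℕ) + 2) < R)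
    (x₀ : Site 3 L) (t : ℝ) :
    0 < l2 (OpPlat.ins φ (flowLiftAt x₀ t (transplantObsL L Λ R f i))) (OpPlat.ins φ (flowLiftAt x₀ t (transplantObsL L Λ R f i))) := by
  obtain ⟨hφ, hφ1, heig⟩ := hvac
  have hL : 1 ≤ L := Nat.one_le_iff_ne_zero.2 (NeZero.ne L)
  set g : Cfg → ℝ := transplantObsL L Λ R f i with hg_def
  have hg : IsPhys g := by
    obtain ⟨hm, hb, hinv⟩ := transplantFn_props (lt_of_lt_of_le one_pos hR) hf hpos i
    exact isPhys_rootPullback hm hb hinv L (Λ / 2)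
  set O : GaugeConfig 3 L SU2 → ℝ := flowLiftAt x₀ t g with hO_def
  have hO : IsPhys O := isPhys_flowLiftAt x₀ t hg
  have hu : IsPhys (OpPlat.ins φ O) := OpPlat.isPhys_ins hφ hO
  set m : ℝ := l2 φ (O * φ) with hm_def
  -- a continuity point of `g` where `g ≠ m`
  obtain ⟨W₁, W₂, hc₁, hc₂, hne₁, heq₂⟩ := transplantObsL_two_values hf hpos hR hΛ hRΛ hL i hRi
  obtain ⟨W, hWc, hWm⟩ : ∃ W : Cfg, ContinuousAt g W ∧ g W ≠ m := by
    by_cases h : g W₂ = m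
    · refine ⟨W₁, hc₁, ?_⟩
      rw [← h]
      show transplantObsL L Λ R f i W₁ ≠ transplantObsL L Λ R f i W₂
      rw [heq₂]; exact hne₁
    · exact ⟨W₂, hc₂, h⟩
  -- pull back to the fine lattice
  obtain ⟨U₀, hU₀⟩ := flowedPolyakovSite_surjective x₀ t W
  have hU₀' : polyakovSite x₀ (wilsonFlow t U₀) = W := hU₀
  have hcontφ : Continuous φ := by
    refine continuous_of_eigen β hφ ?_ heig
    rw [levelValue_zero]; exact (topValue_su2Rep_pos L β).ne'
  have hPi : Continuous fun U : GaugeConfig 3 L SU2 => polyakovSite x₀ (wilsonFlow t U) :=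
    (continuous_polyakovSite x₀).comp (continuous_wilsonFlow t)
  have hOc : ContinuousAt O U₀ := by
    have hWc' : ContinuousAt g ((fun U : GaugeConfig 3 L SU2 => polyakovSite x₀ (wilsonFlow t U)) U₀) := by
      show ContinuousAt g (polyakovSite x₀ (wilsonFlow t U₀))
      rw [hU₀']; exact hWc
    exact ContinuousAt.comp (g := g) hWc' hPi.continuousAt
  have huc : ContinuousAt (OpPlat.ins φ O) U₀ := by
    show ContinuousAt (fun U => (O U - l2 φ (O * φ)) * φ U) U₀
    exact (hOc.sub continuousAt_const).mul hcontφ.continuousAt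
  have hOU₀ : O U₀ = g W := by
    show g (polyakovSite x₀ (wilsonFlow t U₀)) = g W
    rw [hU₀']
  have hne : OpPlat.ins φ O U₀ ≠ 0 := by
    have hval : OpPlat.ins φ O U₀ = (O U₀ - m) * φ U₀ := rfl
    rw [hval, hOU₀]
    exact mul_ne_zero (sub_ne_zero.mpr hWm) (rawVacuum_ne_zero β hφ hφ1 heig U₀)
  exact l2_self_pos_of_continuousAt hu huc hne

/-- ★★ **Clause (o0) of `StaticClauses` for EVERY root-transplant basis** (`TransplantBasisL k L Λ g`, tree `…PolyakovLiftTransplantRoot`), every raw vacuum,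
every fine lattice `(ℤ/L)³` and `β ≥ 1`, whenever `12·physLevel(k+1)·Λ < 1` (the pinned radius `R ≥ 1/(8Λ)` then exceeds `3E/2` for every level of the
family): every dressed lifted channel vector has positive norm (the dressing `K_β^{L}` is injective on physical functions, `l2_iterate_self_pos`).
[cite: Luscher1983, §3] [cite: LuscherWolff1990] -/
theorem dressedLiftFamily_o0_transplantL {L : ℕ} [NeZero L] {β : ℝ} (hβ : 1 ≤ β) {φ : GaugeConfig 3 L SU2 → ℝ} (hvac : IsRawVacuum β φ)
    {k : ℕ} {Λ : ℝ} (hΛ : 0 < Λ) (hΛk : 12 * physLevel (k + 1) * Λ < 1) {g : Fin k → (Cfg → ℝ)} (hbasis : TransplantBasisL k L Λ g) :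
    ∀ i : Fin k, 0 < l2 (dressedLiftFamily β φ g i) (dressedLiftFamily β φ g i) := by
  intro i
  have hgphys : IsPhys (g i) := basisPhysL_transplantBasisL k L Λ g hbasis i
  obtain ⟨f, R, hf, hpos, hR1, hlo, hhi, hgi⟩ := hbasis
  -- the radius exceeds `3·physLevel(i+2)/2`
  have hEi : physLevel ((i : ℕ) + 2) ≤ physLevel (k + 1) := physLevel_mono (by omega) (by omega)
  have hE0 : 0 ≤ physLevel (k + 1) := physLevel_nonneg (by omega)
  have hRi : 3 / 2 * physLevel ((i : ℕ) + 2) < R := by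
    have h1 : 3 / 2 * physLevel (k + 1) * Λ < 1 / 8 := by nlinarith
    have h2 : 3 / 2 * physLevel (k + 1) < R := by
      by_contra h
      have h' : R ≤ 3 / 2 * physLevel (k + 1) := not_lt.1 h
      nlinarith [mul_le_mul_of_nonneg_right h' hΛ.le]
    nlinarith
  have hlift : 0 < l2 (liftVec β φ (g i)) (liftVec β φ (g i)) := by
    rw [hgi i]
    exact liftVec_transplantObsL_pos β hvac hf hpos hR1 hΛ hhi i hRi 0 (flowTime β L)
  exact l2_iterate_self_pos (zero_lt_one.trans_le hβ) (isPhys_liftVec β hvac.1 hgphys) hlift _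

/-- ★★ **The (o0) half of the registered level-`k` text of S-STAT″**: with `lam0 = 1/(24·physLevel(k+1) + 24)` and `L0 = 0`, for every `0 < lam ≤ lam0`, every
fine lattice, every `β` in the femto window, every raw vacuum and EVERY `TransplantBasisL k L (luscherLambda β L) g` basis, all dressed lifted channel
vectors have positive norm. [cite: Luscher1983, §3] [cite: LuscherWolff1990] -/
theorem o0_level_transplantL (k : ℕ) : ∃ lam0 : ℝ, 0 < lam0 ∧ ∀ lam : ℝ, 0 < lam → lam ≤ lam0 →
    ∀ (L : ℕ) [NeZero L] (β : ℝ), InFemtoWindow lam β L → ∀ φ : GaugeConfig 3 L SU2 → ℝ, IsRawVacuum β φ →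
      ∀ g : Fin k → (Cfg → ℝ), TransplantBasisL k L (luscherLambda β L) g →
        ∀ i : Fin k, 0 < l2 (dressedLiftFamily β φ g i) (dressedLiftFamily β φ g i) := by
  have hE0 : 0 ≤ physLevel (k + 1) := physLevel_nonneg (by omega)
  refine ⟨1 / (24 * physLevel (k + 1) + 24), by positivity, fun lam hlam hle L _ β hW φ hvac g hbasis => ?_⟩
  have hΛpos : 0 < luscherLambda β L := lt_of_lt_of_le hlam hW.2.1
  have hΛle : luscherLambda β L ≤ 2 * lam := hW.2.2
  have hΛk : 12 * physLevel (k + 1) * luscherLambda β L < 1 := by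
    have h1 : 12 * physLevel (k + 1) * luscherLambda β L ≤ 24 * physLevel (k + 1) * (1 / (24 * physLevel (k + 1) + 24)) := by
      nlinarith [mul_le_mul_of_nonneg_left (hΛle.trans (by linarith : 2 * lam ≤ 2 * (1 / (24 * physLevel (k + 1) + 24)))) (by positivity : (0:ℝ) ≤ 12 * physLevel (k + 1))]
    have h2 : 24 * physLevel (k + 1) * (1 / (24 * physLevel (k + 1) + 24)) < 1 := by
      rw [mul_one_div, div_lt_one (by positivity)]
      linarith
    linarith
  exact dressedLiftFamily_o0_transplantL hW.1 hvac hΛpos hΛk hbasis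

end Summit.QuantumFields.YangMills.Theorems.FemtoTransferGap.PolyakovLift

end
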